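import Mathlib
import HarnessLib
import HarnessLib.Audit
import Summits.CriticalPhenomena.Statement
import Literature.Probability.Percolation.CriticalContinuity
import Summits.CriticalPhenomena.PercolationContinuityZ3.Theorems.PercThresholdOneThinningLaw

/-!
Route: PercReliabilityThinning

# Route PercReliabilityThinning — subcriticality is the failure process of the would-be cluster —
ν<1 makes straight critical connections exponentially rare, a jump at p_c needs straight highways

X = K1 ∧ K2 ("it suffices to show"), realising card reliability-rate-thinning-dictionary (spine,
sole card). K1 = NuSupLtOne: the axis
correlation length of subcritical bond percolation on ℤ³ obeys ξ(p) ≤ C (p_c − p)^(−ν') for some ν'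
< 1 near p_c, typed in the all-n form
τ_p(0, n e₁) ≤ exp(−n (p_c − p)^ν' / C) (equivalent by Grimmett1999 Thm (6.44): τ_p(0, ne₁) ≤
e^(−n/ξ(p)) for every n and −(1/n) log τ_p(0,ne₁) → 1/ξ(p)).
K2 = StraightHighways: if θ(p_c) > 0, the would-be critical infinite cluster carries straight
highways — for some dilation ρ, some c > 0 and
infinitely many n, P_(p_c)(0 ↔ ne₁ with chemical distance D ≤ ρn) ≥ c·τ_(p_c)(0, ne₁). The glue is
the thinning dictionary of the card:
deleting each open edge of ω ~ P_(p_c) independently with probability ε gives law P_((1−ε)p_c)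
exactly (ThinningLaw); a surviving geodesic gives
τ_((1−ε)p_c)(0,ne₁) ≥ (1−ε)^(ρn) · P_(p_c)(0 ↔ ne₁, D ≤ ρn) (ThinningPathBound, the Esary–Proschan
single-path bound); hence K1 makes straight
critical connections exponentially rare in every world (TortuosityTransfer ⟹ StraightRunsRare),
while K2 with τ_(p_c) ≥ θ(p_c)² (proved in
tree) makes them positively frequent in a jump world (Assembly) — so θ(p_c) = 0.
Lean: `(∃ ν' : ℝ, ν' < 1 ∧ ∃ C : ℝ, 0 < C ∧ ∃ δ₀ : ℝ, 0 < δ₀ ∧ ∀ p : unitInterval,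
(Literature.Probability.Percolation.criticalProbI 3 : ℝ) - δ₀ < (p : ℝ) → (p : ℝ) <
Literature.Probability.Percolation.criticalProbI 3 → ∀ n : ℕ, Literature.Probability.Percolation.tau
3 p 0 (Pi.single 0 (n : ℤ)) ≤ Real.exp (-(((Literature.Probability.Percolation.criticalProbI 3 : ℝ)
- (p : ℝ)) ^ ν' * (n : ℝ) / C))) ∧ (0 < Literature.Probability.Percolation.theta
(Literature.Probability.LatticeModels.zdGraph 3) 0 (Literature.Probability.Percolation.criticalProbI
3) → ∃ ρ : ℕ, ∃ c : ℝ, 0 < c ∧ ∀ N : ℕ, ∃ n : ℕ, N ≤ n ∧ c * Literature.Probability.Percolation.tau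
3 (Literature.Probability.Percolation.criticalProbI 3) 0 (Pi.single 0 (n : ℤ)) ≤
(Literature.Probability.Percolation.bondPercolation (Literature.Probability.LatticeModels.zdGraph 3)
(Literature.Probability.Percolation.criticalProbI 3)).real {ω | ω ∈
Literature.Probability.Percolation.openConn (0 : Fin 3 → ℤ) (Pi.single 0 (n : ℤ)) ∧
(Literature.Probability.Percolation.openGraph ω).dist 0 (Pi.single 0 (n : ℤ)) ≤ ρ * n})`

## Assembly
Given StraightRunsRare and StraightHighways: if θ* := θ(p_c) > 0 (else done, θ ≥ 0 by
measureReal_nonneg), StraightHighways gives ρ, c > 0 and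
infinitely many n with c·τ_(p_c)(0,ne₁) ≤ P_(p_c)(0 ↔ ne₁, D ≤ ρn); τ_(p_c)(0,ne₁) ≥ θ*²
(Grimmett1999_theta_sq_le_openConn_holds, in tree,
from AKN uniqueness + FKG, with tau_def); StraightRunsRare(ρ) bounds the right side by e^(−c'n) for
n ≥ N; choosing n beyond N and beyond the
point where e^(−c'n) < cθ*² is absurd; hence θ(p_c) = 0, which is PercolationContinuityZ3
(percolationContinuityZ3_iff). About 80 Lean lines,
provable now. The deciding theorem (glue.lean): closes h_K1 h_K2 h_TPB h_TT h_A := h_A (h_TT h_K1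
h_TPB) h_K2.

Rationale: WHY THIS LINE. Mechanism (card reliability-rate-thinning-dictionary): the subcritical phase is the
i.i.d. failure process of the critical configuration —
τ_(p(1−ε))(x,y) = E_p[S_ε(x,y;ω)] with S_ε the Moore–Shannon / Esary–Proschan two-terminal
reliability of the random network ω (MooreShannon1956,
EsaryProschan1963; the identity is the monotone coupling read at two levels, Grimmett1999 §1.3,
LyonsPeres2016 Ex. 5.7) — so 1/ξ((1−ε)p_c) is the
reliability RATE of the would-be infinite cluster, and every structure that cluster typically offers
between far points bounds ν from below:
paths of bounded dilation give ν ≥ 1 (this route), ribbons give ν ≥ w, bars an essential singularity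
(Kosterlitz–Thouless; not filed).
Imported areas: network reliability (single-path lower bound), subadditivity (Grimmett1999 Thm
(6.44)), uniqueness ⟹ τ ≥ θ²
(AizenmanKestenNewmanCMP1987; PROVED in tree as Grimmett1999_theta_sq_le_openConn_holds),
chemical-distance geometry (AntalPisztora1996 linear
above p_c, GaretMarchand2007 its large deviations; KestenZhang1993, AizenmanBurchardDuke1999,
DamronHansonSosoe2017 tortuosity at p_c in 2D;
numerics ZhouYangDengZiff2012 (doi:10.1103/PhysRevE.86.061101) d_min = 1.3756(6),
WangZhouZhangGaroniDeng2013 ν = 0.8764(12)). What it does that sibling routes do not: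
PercHollowCells,
PercDebrisSweep and PercLoopDislocationCovers also trade a subcritical exponent against a jump-world
law, but through volumes, susceptibilities
or cover slopes; here the subcritical input is the correlation-LENGTH exponent, the jump-world law
is purely geometric (chemical distance), the
glue is an exact identity rather than a differential inequality, and the intermediate node
StraightRunsRare ("ν < 1 ⟹ linear critical geodesics
are exponentially rare", a provable transfer) is a theorem-shaped statement about the real world
with a second, p_c-only engine (Kesten–Zhang /
Aizenman–Burchard tortuosity). PercThresholdOne uses the same thinning identity qualitatively
(p_c(ω_(p_c)) = 1); this route uses its rate.
Negatives index: none of the 5 refuted statements (4 SAW/Cardy, 1 uniform-in-p in-box bound,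
stmt-7073) is touched — nothing here is uniform in p.

RANKED CRUXES. #2 NuSupLtOne (crux) — (card K1) ν_sup < 1 for the axis correlation length of bond
percolation on ℤ³: there are ν' < 1, C > 0, δ₀ > 0 such that for all p ∈ (p_c − δ₀, p_c) and all n ∈
ℕ, τ_p(0, n e₁) ≤ exp(−(p_c − p)^ν' · n / C), i.e. ξ(p) ≤ C (p_c − p)^(−ν') (Grimmett1999 Thm
(6.44): τ_p(0,ne₁) ≤ e^(−n/ξ(p)) for all n). True for subcritical reasons if ν = 0.876(1) is the
exponent; type (d) of the census: an intermediate subcritical statement, not the conjunct.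
[difficulty: open-problem] (why it might fail: a polynomial, nearly sharp (ν' < 1 vs ν = 0.876)
ξ-bound is far beyond DKT's ξ ≤ exp(Cδ^-2) (arXiv:1902.03207 Thm 2); OSSS/DCT inequalities give no
power of δ in d = 3; a jump world forces only ν ≥ 2/3 (ChayesEtAl1986), so no contradiction engine
helps.) [DuminilcopinKozmaTassion2020, arXiv:1902.03207, Grimmett1999, ChayesEtAl1986,
WangZhouZhangGaroniDeng2013, arXiv:1302.0421, Hutchcroft2020]
#3 StraightHighways (crux) — (card K2) if θ(p_c(ℤ³)) > 0 then for some dilation ρ ∈ ℕ and c > 0 and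
infinitely many n: P_(p_c)(0 ↔ ne₁ and D_ω(0, ne₁) ≤ ρ·n) ≥ c · τ_(p_c)(0, ne₁), where D_ω is the
graph distance of the open graph (chemical distance, Mathlib SimpleGraph.dist on openGraph ω) — the
would-be critical infinite cluster (density θ*, unique, τ_(p_c) ≥ θ*²) offers dilation-bounded
routes between far axis points with positive relative frequency; implied via Kingman by a finite
Palm mean of the chemical gap between consecutive cluster points on the axis. Vacuous in the real
world; a same-p structure law (census type (b)). [difficulty: open-problem] (why it might fail: a
same-p 'density ⟹ linear chemical distance' law is Antal–Pisztora without its sprinkling margin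
(SprinklingRenormalisation); dense FKG sponges can be tortuous (cards fkg-kills-fragility,
potemkin-weaver), so Bernoulli structure (insertion tolerance, BK) must carry it.)
[AntalPisztora1996, GaretMarchand2007, Grimmett1999, AizenmanKestenNewmanCMP1987, Coniglio1982]
#4 StraightRunsRare (crux) — (card P2, quantitative form; the node the assembly consumes) at p_c(ℤ³)
straight connections are exponentially rare, in every world: for every ρ ∈ ℕ there are c > 0 and N
with P_(p_c)(0 ↔ ne₁ and D_ω(0,ne₁) ≤ ρ·n) ≤ e^(−c·n) for all n ≥ N. Implied by NuSupLtOne through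
the thinning dictionary (TortuosityTransfer, provable now); a second, independent engine is p_c-only
tortuosity (superlinearity of critical geodesics in probability at one scale, Kesten–Zhang /
Aizenman–Burchard, plus a multiscale BK block argument). Weaker than NuSupLtOne, so it is the
cheaper real-world target; with StraightHighways it already closes the route. [deps: NuSupLtOne]
[difficulty: open-problem] (why it might fail: in the real world it needs superlinear critical
chemical distance in probability at one scale — proved only in 2D (KestenZhang1993,
AizenmanBurchardDuke1999); in 3D the Aizenman–Burchard input is an annulus bound of conjunct
strength — or ν < 1; false in a jump world with highways.) [KestenZhang1993,
AizenmanBurchardDuke1999, DamronHansonSosoe2017, ZhouYangDengZiff2012,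
doi:10.1103/PhysRevE.86.061101, Grimmett1999]
#9 ThinningLaw (support) — thinning of the monotone coupling (item shared verbatim with
PercThresholdOne.ThinningLaw = stmt-CriticalPhenomena-5265, grounded: LyonsPeres2016 Ex. 5.7 with
printed solution): for p, q ∈ [0,1], under labelMeasure ⊗ P_q the configuration configOfLabels p U
(zdGraph 3) ∩ η has law P_(q·p). [difficulty: provable-now] [LyonsPeres2016, Grimmett1999]
#9 ThinningPathBound (support) — (card P1, the Esary–Proschan single-path bound under thinning) for
all p, q ∈ [0,1], x, y ∈ ℤ³, L ∈ ℕ: P_p(x ↔ y and D_ω(x,y) ≤ L) · q^L ≤ τ_(q·p)(x, y) — condition on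
the level-p configuration, keep each open edge independently with probability q (ThinningLaw), a
geodesic of length ≤ L survives with probability ≥ q^L; Fubini over the product and measurability of
{D ≤ L} as a finite union of path cylinders. About 200 Lean lines on top of ThinningLaw.
[difficulty: provable-now] [EsaryProschan1963, MooreShannon1956, LyonsPeres2016, Grimmett1999]
#9 TortuosityTransfer (support) — ThinningPathBound → NuSupLtOne → StraightRunsRare (binder order of
the filed decl since rev 2; real analysis, about 150 Lean lines): given ρ take p = p_c and q = 1 − ε
with ε < min(1/2, δ₀/p_c) and ε^(1−ν') < p_c^ν'/(2ρC) (possible since ν' < 1; 0 < p_c < 1 by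
Grimmett1999_criticalProb_pos_lt_one_holds), so that (1−ε)p_c ∈ (p_c − δ₀, p_c); then P_(p_c)(0 ↔
ne₁, D ≤ ρn)·(1−ε)^(ρn) ≤ τ_((1−ε)p_c)(0, ne₁) ≤ exp(−(εp_c)^ν' n / C) and log(1/(1−ε)) ≤ 2ε give
the rate c = (εp_c)^ν'/C − 2ρε > 0 with N = 0. [difficulty: provable-now] [Grimmett1999,
Coniglio1982]

TWO-LAYER PLAN. Foreseen glued splits, none filed now (k ≤ 3, depth 1): StraightHighways ⇐
FiniteChemicalGap (θ(p_c) > 0 → finite Palm mean of the chemical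
distance between consecutive points of C_∞ ∩ axis) → KingmanHighways (subadditivity along the axis
points ⟹ highways with relative frequency
≥ 1/2) → StraightHighways; StraightRunsRare ⇐ OneScaleTortuosity (∀ρ' ∃L: an open path crossing Λ_L
with length ≤ ρ'L is rare at p_c) →
BlockBK (multiscale BK: being fast on a positive fraction of blocks is exponentially rare) →
StraightRunsRare; NuSupLtOne ⇐ XiPolynomial (some
power A) → XiSharpening (A < 1) → NuSupLtOne, only once an engine exists. Second assembly (the
card's KT half, later, by route edit):
RibbonsInK (width-w(ε) open ribbons typical between far points of C_∞(p_c), w(ε) ≥ ε^(−2−κ)) + a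
vendored DKT fact ξ(p_c − δ) ≤ exp(Cδ^(−2)) →
conjunct, by the same three lines with ribbon reliability (Cε)^w per unit length.

KILL CRITERIA. NuSupLtOne refuted (a theorem ξ(p) ≥ c (p_c − p)^(−1) on ℤ³, i.e. ν ≥ 1) ⇒ drop K1
and TortuosityTransfer and re-glue closes through
StraightRunsRare directly (route edit --closes-file); StraightRunsRare refuted (straight critical
connections only subexponentially rare in
the real world — which through the provable transfer also refutes K1) ⇒ close
refuted:StraightRunsRare: the structural direction of the
dictionary is dead and the witness is a first-class fact about critical chemical distance for the
tortuosity cards. StraightHighways can only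
be refuted together with the conjunct (its hypothesis is θ(p_c) > 0); a refuter census showing that
no Bernoulli-specific engine reaches it
short of sprinkled renormalisation ⇒ pivot to the KT half (ribbons + DKT) or retire exhausted with
the proved supports as dossier. θ(p_c) = 0
proved by any sibling route moots everything; PercThresholdOne's NoFragileGiantFKG proved would
supersede K2.

NOT DECOMPOSED YET. The KT half (card K2′ RibbonsInK and P3 ReliabilityLadder: path rate ρ
log(1/(1−ε)), k-strand ladders 2 − 1/k, ribbons (Cε)^w, bars (Cε)^(w²))
— it needs a vendored DKT Thm 2 fact and a typed notion of embedded open ribbons, both deferred; the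
qualitative dichotomy JumpDichotomy
(θ(p_c) > 0 ⇒ ν_inf ≥ 1 ∨ tortuous cluster — TortuosityTransfer read contrapositively along a
subsequence), not an item, provers may attach it
with --supports TortuosityTransfer; the dual cutset transfer P4 (θ(p_c+η) − θ(p_c) ≤
η/(1−p_c)·E[M_∞; 0↮∞]) — a different functional, left to
the card; a Literature definition of the axis correlation length ξ(p) (Fekete) — avoided by the
all-n form of K1; the constants C, δ₀, ρ, c are
existential and never optimised; no Kingman/Palm formalisation is requested before StraightHighways
is split.

CHEAPEST FALSIFIER. Numerical: estimate f_ρ(n) = P_(p_c)(D(0,ne₁) ≤ ρn | 0 ↔ ne₁) for bond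
percolation on ℤ³ at p_c = 0.2488126, ρ ∈ {2, 3}, n ∈ {8, …, 48} (BFS
chemical distances on the clusters of a 128³ torus, ~10³ samples): exponential decay in n is what
StraightRunsRare (and, through the proved
transfer, ν < 1) predicts, consistent with d_min = 1.3756(6) (ZhouYangDengZiff2012,
doi:10.1103/PhysRevE.86.061101); a clearly polynomial decay would refute StraightRunsRare and
hence NuSupLtOne — the whole real-world side at once. Lookup (novelty, not truth): a printed "ν < 1
⟹ exponential rarity of linear critical
geodesics" or "θ(p_c) > 0 ⟹ ν ≥ 1" (searched crossref/arxiv/zbmath 2026-08-15, none; Coniglio1982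
d_min ≥ 1/ν is the ε → 0 scaling shadow).
The card's kit job j002787 (reliability gain on a 32³ torus) bears on the KT half only. Not run here
(compute-free hub; plancard one-shot).

NUMBERS. ν(ℤ³) = 0.8764(12) (y_t = 1.1410(15), arXiv:1302.0421), margin to ν' < 1 is 0.12; d_min(ℤ³)
= 1.3756(6) (ZhouYangDengZiff2012, doi:10.1103/PhysRevE.86.061101 — NOT arXiv:1110.1955 / bib
ZhouEtAl2012, which are other papers), d_min(ℤ²) =
1.1306(3), > 1 rigorously in 2D (KestenZhang1993, AizenmanBurchardDuke1999); p_c(ℤ³, bond) =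
0.2488126(5); rigorous ξ bounds on ℤ³: ξ(p_c − δ)
≤ exp(Cδ^(−2)) (arXiv:1902.03207 Thm 2) and ν ≥ 2/3 in finite-size form (ChayesEtAl1986); jump
world: γ ≥ 2 (Newman1986); Coniglio1982: d_min ≥
1/ν at scaling level, saturated at d_c = 6 (d_min = 2 = 1/ν); mean-field sanity d > 6: ν = 1/2 < 1,
StraightRunsRare expected true, no
highways, θ(p_c) = 0 — consistent. TortuosityTransfer's rate: c_ρ ≍ ρ^(−ν'/(1−ν')) as ρ → ∞. Items
at open: 7 (3 cruxes, 3 support, 1 assembly).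

DEFINITION REQUESTS. None needed for the items: chemical distance is Mathlib's SimpleGraph.dist on
Literature.Probability.Percolation.openGraph ω; axis points are
Pi.single 0 (n : ℤ); Literature.Probability.Percolation.bondPercolation, openConn, openGraph, theta,
criticalProbI, configOfLabels, labelMeasure and
Literature.Probability.LatticeModels.zdGraph exist (lean search --decl; Sketch.lean rc 0); τ_p(x,y)
is written as its definiens
(bondPercolation (zdGraph 3) p).real (openConn x y) since rev 2, so
Literature.Probability.Percolation.TwoPointFunction (tau) is not imported. Wanted cite fact (for the
KT half, filed after
open if the gate answers): DuminilcopinKozmaTassion2020 Thm 2, ξ(p) ≤ exp(C |p − p_c|^(−2)) on ℤ^d.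
Suggested, not required: a Literature
definition corrLength d p := (lim −(1/n) log τ_p(0, n e₁))^(−1) with Grimmett1999 Thm (6.44)/(6.46)
as API, which would let K1 be restated verbatim.
Cone (route-repair 5043789e gen 1 + gen 2, 2026-08-15): needs-fact: none. The route declares ONE
import, Literature.Probability.Percolation.CriticalContinuity
(home of the target and of criticalProbI; it pulls in Percolation, BernoulliPercolation,
ThermodynamicLimit, LatticeGraph), no item mentions a named fact,
and the gate's constant cone is 24 consts / 0 unproved (staffable). The 16 `def … : Prop` lacking
`_holds` in the MODULE cone (the priority guardrail's
module_cone; list reconstructed by hand — payload list empty, run/shared/views/cone/ absent) all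
enter through the operator-owned header of
Summits/CriticalPhenomena/PercolationContinuityZ3/Statement.lean (it imports CardyFormula,
SelfAvoidingWalk and ScalingLimit3D besides CriticalContinuity) and the gate boilerplate `import
Summits.CriticalPhenomena.Statement`; they are 6 open
statements (PercolationContinuityZ3 itself, CardyFormulaZ2, SAWScalingLimit,
CritIsing3DConformalLimit, CritIsing3DEuclideanLimit, CardyUniversality) and 10
facts foreign to bond percolation on ℤ³ (SLE: HasSLETrace, hasSLETrace_eight,
tendsto_norm_sleTrace_atTop, exists_isSLECurve; isoradial planar percolation:
gm_boxCrossingBounds_uniform, gm_boxCrossing, gm_theta_critical_eq_zero, gm_universality_oneArm,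
gm_universality_arms; d ≥ 11: FitznerVanDerHofstad2017_beta_eq_one).
No route of this sub (all 54 Theses share that header) can shed them by a route edit; the fix is
operator-side: sub-Statement imports → CriticalContinuity
+ HarnessLib only and Theses boilerplate importing the SUB Statement module (16 → 2), plus a cone
metric that skips open/conjecture/summit decls and
either moves FitznerVanDerHofstad2017_beta_eq_one out of CriticalContinuity.lean or uses the gate's
constant cone (→ 0).

Novelty: Searches (2026-08-15): `lit search --source crossref` "chemical distance critical percolation large
deviations" (7: GaretMarchand2007
supercritical LD, Cerf 2018 Astérisque, Grimmett 1985 FPP LD — nothing at p_c), "chemical distance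
critical percolation superlinear Aizenman
Burchard" (8: DamronHansonSosoe2017, AizenmanBurchardDuke1999, Barsky–Aizenman 1991), "correlation
length exponent critical percolation bound nu"
(8: Nguyen 1987, Cerf 2015, van den Berg–van Engelenburg 2022, Hara 1990 — no polynomial ξ bound in
d = 3), "two-terminal reliability
percolation thinning correlation length" (8: reliability-engineering bounds, Hunt 2005 — no transfer
to ξ); `--source arxiv` "chemical distance
critical percolation" (10: DHS 1506.03461 / 1601.03464 / 1708.03643, Damron survey 1602.00775,
Chatterjee–Hanson–Sosoe 2509.06236 high-d,
Ganguly–Lee 2005.08934, Sosoe–Reeves 2001.07872, Đanković–Markering–Miller 2604.14122 planar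
intrinsic metric — none bounds ν by geometry or
thins to (1−ε)p_c), "correlation length percolation exponent inequality" (1, FSS numerics);
`--source zbmath` "chemical distance critical
percolation" (8: KestenZhang1993 tortuosity 2D, Ziff 1999, Ganguly–Lee 2022); local searchd
(--hybrid/vsearch) down rc 75, openalex/s2
rate-limited; held Grimmett1999 read (PDF pp. 139–141: Thm (6.44), (6.46), ξ = 1/φ, (6.56)); `lit
read doi:10.1007/bf01053586` paywalled
(want filed); the 48 Theses files of the sub scanned by thesis line; stmt-CriticalPhenomena-5265's
grounder note  [refs: 10.1007/bf01053586`, 1902.03207, doi:10.1007/bf01053586, GaretMarchand2007, DamronHansonSosoe2017, AizenmanBurchardDuke1999, KestenZhang1993, Grimmett1999, LyonsPeres2016, Coniglio1982, AntalPisztora1996, DuminilcopinKozmaTassion2020]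

Barriers (technique_class: thinning-coupling, reliability, chemical-distance): - technique_class: thinning-coupling, reliability, chemical-distance
- Literature.Barriers.CriticalPhenomena.SprinklingRenormalisation: StraightHighways does NOT evade
it — a same-p "density ⟹ highways" law is exactly where Antal–Pisztora spends sprinkling; the bet is
that the law needed is weaker than a finite-size criterion (dilation-bounded routes with positive
RELATIVE frequency along a subsequence: no gluing inequality, no box criterion) and that it is
paired with a subcritical exponent instead of a criterion at p_c; NuSupLtOne and StraightRunsRare
live at p < p_c / in all worlds and never renormalise at p_c.
- Literature.Barriers.CriticalPhenomena.SubexponentialGrowthZd: evaded, and its Narrow form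
respected — every rate is taken at the fixed subcritical parameter (1−ε)p_c, where Fekete rates are
theorems (Grimmett1999 Thm (6.44)), and moved to p_c by the exact thinning identity, not by a
p-uniform rate or left-continuity; the rates blow up as ε → 0 as they must.
- Literature.Barriers.CriticalPhenomena.LaceExpansionHighDimension: outside the class — no
expansion, no triangle condition, no η; dimension enters only through the sign of 1 − ν (positive
exactly for d ≥ 3), imported as the crux NuSupLtOne; conceded: nothing here computes ν.
- Literature.Barriers.CriticalPhenomena.TreesPercolatingAtCriticality: the tree and log-wedge
witnesses percolate at p_c with τ_(p_c)(x,y) → 0, so they are excluded at the assembly's τ ≥ θ² step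
(uniqueness on ℤ³, AKN), as they must be; St

History (route lifecycle, newest last):
- 2026-08-15T18:41:46Z · rev 2: restated NuSupLtOne (stmt-CriticalPhenomena-11457), StraightHighways (stmt-CriticalPhenomena-11458), ThinningPathBound (stmt-CriticalPhenomena-11460), TortuosityTransfer (stmt-CriticalPhenomena-11461) — cone repair (rrepair unit 5043789e): needs-fact: none. The 7 items use only criticalProbI/theta/bondPercolatio (planner-rrepair-CriticalPhenomena-PercReliabil-5043789e-0)

sub-problem: PercolationContinuityZ3 · status: draft · opened planner-plancard-CriticalPhenomena-Percolatio-3383c9d3-0 2026-08-15T18:05:13Z · rev 4 · ledger route-CriticalPhenomena-PercReliabilityThinning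
GENERATED by the gate from the ledger (D-0016/17). Provers cite these decls: `theorem foo : Summit.CriticalPhenomena.PercolationContinuityZ3.Theses.PercReliabilityThinning.<Decl> := …` in Summits/CriticalPhenomena/PercolationContinuityZ3/Theorems/<Name>.lean.
-/

namespace Summit.CriticalPhenomena.PercolationContinuityZ3.Theses.PercReliabilityThinning

open scoped BigOperators Topology Manifold Classical MeasureTheory ProbabilityTheory Matrix InnerProductSpace ComplexConjugate ContinuousMap
open Filter Set Function TopologicalSpace MeasureTheory

attribute [summit_statement] _root_.PercolationContinuityZ3

-- earlier NuSupLtOne (stmt-CriticalPhenomena-11457, replaced 2026-08-15T18:41:46Z -> stmt-CriticalPhenomena-11744): retired by None — ∃ ν' : ℝ, ν' < 1 ∧ ∃ C : ℝ, 0 < C ∧ ∃ δ₀ : ℝ, 0 < δ₀ ∧ ∀ p : unitInterval, (Literature.Probability.Percolation.criticalProbI 3 : ℝ) - δ₀ < (p : ℝ) → (p : ℝ) < Literature.Probability.Percolation.criticalProbI 3 → ∀ n : ℕ, Literature.Probability.Percolation.tau 3 p 0 (P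
/-- item stmt-CriticalPhenomena-11744 · crux · rank 2 · open · by planner
why it might fail: Needs a near-sharp polynomial bound ξ(p) ≤ C(p_c−p)^(−ν'), ν' < 1, on ℤ³ (numerics ν = 0.8764(12), margin 0.12); the only rigorous upper bound is ξ_p ≤ exp(C|p−p_c|^(−2)) (DKT Thm 2, arXiv:1902.03207); DRT/OSSS sharpness gives no power of δ; lower bounds stop near ν ≥ 2/d, so ν ≥ 1 is not excluded.
sources: DuminilcopinKozmaTassion2020, arXiv:1902.03207, DuminilCopinRaoufiTassion2019, ChayesEtAl1986, WangZhouZhangGaroniDeng2013, Hutchcroft2020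
[crux] (card K1) ν_sup < 1 for the axis correlation length of bond percolation on ℤ³: there are ν' <
1, C > 0, δ₀ > 0 such that for all p ∈ (p_c − δ₀, p_c) and all n ∈ ℕ, τ_p(0, n e₁) ≤ exp(−(p_c −
p)^ν' · n / C), i.e. ξ(p) ≤ C (p_c − p)^(−ν') (Grimmett1999 Thm (6.44): τ_p(0,ne₁) ≤ e^(−n/ξ(p)) for
all n). True for subcritical reasons if ν = 0.876(1) is the exponent; type (d) of the census: an
intermediate subcritical statement, not the conjunct. (rev 1, cone repair 2026-08-15: τ_p(x,y) is
written out as its definiens P_p(x ↔ y) = (bondPercolation (zdGraph 3) p).real (openConn x y) —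
TwoPointFunction.tau_def, rfl — so the route file imports only
Literature.Probability.Percolation.CriticalContinuity; statement unchanged up to Iff.rfl,
DefEqCheck.lean rc 0.) [difficulty: open-problem] -/
@[route_item "route-CriticalPhenomena-PercReliabilityThinning"]
def NuSupLtOne : Prop :=
  ∃ ν' : ℝ, ν' < 1 ∧ ∃ C : ℝ, 0 < C ∧ ∃ δ₀ : ℝ, 0 < δ₀ ∧ ∀ p : unitInterval, (Literature.Probability.Percolation.criticalProbI 3 : ℝ) - δ₀ < (p : ℝ) → (p : ℝ) < Literature.Probability.Percolation.criticalProbI 3 → ∀ n : ℕ, (Literature.Probability.Percolation.bondPercolation (Literature.Probability.LatticeModels.zdGraph 3) p).real (Literature.Probability.Percolation.openConn (0 : Fin 3 → ℤ) (Pi.single 0 (n : ℤ))) ≤ Real.exp (-(((Literature.Probability.Percolation.criticalProbI 3 : ℝ) - (p : ℝ)) ^ ν' * (n : ℝ) / C))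

-- earlier StraightHighways (stmt-CriticalPhenomena-11458, replaced 2026-08-15T18:41:46Z -> stmt-CriticalPhenomena-11745): retired by None — 0 < Literature.Probability.Percolation.theta (Literature.Probability.LatticeModels.zdGraph 3) 0 (Literature.Probability.Percolation.criticalProbI 3) → ∃ ρ : ℕ, ∃ c : ℝ, 0 < c ∧ ∀ N : ℕ, ∃ n : ℕ, N ≤ n ∧ c * Literature.Probability.Percolation.tau 3 (Literature.Pr
/-- item stmt-CriticalPhenomena-11745 · crux · rank 3 · closed · proved by Summit.CriticalPhenomena.PercolationContinuityZ3.Theorems.PercReliabilityThinningStraightHighways.straightHighways_proof @ 2c68edf3bc53 (prover) · by planner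
why it might fail: Bites only if θ(p_c) > 0, where BGN (Grimmett1999 Thm (7.35): θ_H(p_c) = 0) forbids percolation in every half-space and slab, so Antal–Pisztora/Garet–Marchand renormalisation, the one engine for linear chemical distance, has no room; density, uniqueness, FKG do not force dilation-bounded geodesics.
sources: AntalPisztora1996, BarskyGrimmettNewman1991, GaretMarchand2007, arXiv:1803.03141, AizenmanKestenNewmanCMP1987, Grimmett1999
[crux] (card K2) if θ(p_c(ℤ³)) > 0 then for some dilation ρ ∈ ℕ and c > 0 and infinitely many n:
P_(p_c)(0 ↔ ne₁ and D_ω(0, ne₁) ≤ ρ·n) ≥ c · τ_(p_c)(0, ne₁), where D_ω is the graph distance of the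
open graph (chemical distance, Mathlib SimpleGraph.dist on openGraph ω) — the would-be critical
infinite cluster (density θ*, unique, τ_(p_c) ≥ θ*²) offers dilation-bounded routes between far axis
points with positive relative frequency; implied via Kingman by a finite Palm mean of the chemical
gap between consecutive cluster points on the axis. Vacuous in the real world; a same-p structure
law (census type (b)). (rev 1, cone repair 2026-08-15: τ_p(x,y) is written out as its definiens
P_p(x ↔ y) = (bondPercolation (zdGraph 3) p).real (openConn x y) — TwoPointFunction.tau_def, rfl —
so the route file imports only Literature.Probability.Percolation.CriticalContinuity; statement
unchanged up to Iff.rfl, DefEqCheck.lean rc 0.) [difficulty: open-problem] -/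
@[route_item "route-CriticalPhenomena-PercReliabilityThinning"]
def StraightHighways : Prop :=
  0 < Literature.Probability.Percolation.theta (Literature.Probability.LatticeModels.zdGraph 3) 0 (Literature.Probability.Percolation.criticalProbI 3) → ∃ ρ : ℕ, ∃ c : ℝ, 0 < c ∧ ∀ N : ℕ, ∃ n : ℕ, N ≤ n ∧ c * (Literature.Probability.Percolation.bondPercolation (Literature.Probability.LatticeModels.zdGraph 3) (Literature.Probability.Percolation.criticalProbI 3)).real (Literature.Probability.Percolation.openConn (0 : Fin 3 → ℤ) (Pi.single 0 (n : ℤ))) ≤ (Literature.Probability.Percolation.bondPercolation (Literature.Probability.LatticeModels.zdGraph 3) (Literature.Probability.Percolation.criticalProbI 3)).real {ω | ω ∈ Literature.Probability.Percolation.openConn (0 : Fin 3 → ℤ) (Pi.single 0 (n : ℤ)) ∧ (Literature.Probability.Percolation.openGraph ω).dist 0 (Pi.single 0 (n : ℤ)) ≤ ρ * n}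

/-- item stmt-CriticalPhenomena-11459 · crux · rank 4 · open · by planner
why it might fail: Exponential rarity for EVERY ρ is beyond path counting (μ(ℤ³)·p_c ≈ 4.684·0.2488 ≈ 1.17 > 1); a p_c-only proof needs one-scale tortuosity of critical geodesics plus a multiscale BK step, known only in 2D via RSW (Kesten–Zhang, Aizenman–Burchard), not on ℤ³; else as hard as ν < 1; false w/ highways.
sources: KestenZhang1993, AizenmanBurchardDuke1999, DamronHansonSosoe2017, DuminilCopinHammond2013, doi:10.1103/physreve.86.061101, WangZhouZhangGaroniDeng2013
[crux] (card P2, quantitative form; the node the assembly consumes) at p_c(ℤ³) straight connections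
are exponentially rare, in every world: for every ρ ∈ ℕ there are c > 0 and N with P_(p_c)(0 ↔ ne₁
and D_ω(0,ne₁) ≤ ρ·n) ≤ e^(−c·n) for all n ≥ N. Implied by NuSupLtOne through the thinning
dictionary (TortuosityTransfer, provable now); a second, independent engine is p_c-only tortuosity
(superlinearity of critical geodesics in probability at one scale, Kesten–Zhang / Aizenman–Burchard,
plus a multiscale BK block argument). Weaker than NuSupLtOne, so it is the cheaper real-world
target; with StraightHighways it already closes the route. [deps: NuSupLtOne] [difficulty:
open-problem] -/
@[route_item "route-CriticalPhenomena-PercReliabilityThinning"]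
def StraightRunsRare : Prop :=
  ∀ ρ : ℕ, ∃ c : ℝ, 0 < c ∧ ∃ N : ℕ, ∀ n : ℕ, N ≤ n → (Literature.Probability.Percolation.bondPercolation (Literature.Probability.LatticeModels.zdGraph 3) (Literature.Probability.Percolation.criticalProbI 3)).real {ω | ω ∈ Literature.Probability.Percolation.openConn (0 : Fin 3 → ℤ) (Pi.single 0 (n : ℤ)) ∧ (Literature.Probability.Percolation.openGraph ω).dist 0 (Pi.single 0 (n : ℤ)) ≤ ρ * n} ≤ Real.exp (-(c * n))

-- earlier ThinningPathBound (stmt-CriticalPhenomena-11460, replaced 2026-08-15T18:41:46Z -> stmt-CriticalPhenomena-11746): retired by None — ∀ (p q : unitInterval) (x y : Fin 3 → ℤ) (L : ℕ), (Literature.Probability.Percolation.bondPercolation (Literature.Probability.LatticeModels.zdGraph 3) p).real {ω | ω ∈ Literature.Probability.Percolation.openConn x y ∧ (Literature.Probability.Percolation.openGra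
/-- item stmt-CriticalPhenomena-11746 · support · rank 9 · closed · proved by Summit.CriticalPhenomena.PercolationContinuityZ3.Theorems.ThinningPath.thinningPathBound_proof @ c1f7d3ade511 (prover) · by planner
sources: EsaryProschan1963, MooreShannon1956, LyonsPeres2016, Grimmett1999
[support] (card P1, the Esary–Proschan single-path bound under thinning) for all p, q ∈ [0,1], x, y
∈ ℤ³, L ∈ ℕ: P_p(x ↔ y and D_ω(x,y) ≤ L) · q^L ≤ τ_(q·p)(x, y) — condition on the level-p
configuration, keep each open edge independently with probability q (ThinningLaw), a geodesic of
length ≤ L survives with probability ≥ q^L; Fubini over the product and measurability of {D ≤ L} as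
a finite union of path cylinders. About 200 Lean lines on top of ThinningLaw. (rev 1, cone repair
2026-08-15: τ_p(x,y) is written out as its definiens P_p(x ↔ y) = (bondPercolation (zdGraph 3)
p).real (openConn x y) — TwoPointFunction.tau_def, rfl — so the route file imports only
Literature.Probability.Percolation.CriticalContinuity; statement unchanged up to Iff.rfl,
DefEqCheck.lean rc 0.) [difficulty: provable-now] -/
@[route_item "route-CriticalPhenomena-PercReliabilityThinning"]
def ThinningPathBound : Prop :=
  ∀ (p q : unitInterval) (x y : Fin 3 → ℤ) (L : ℕ), (Literature.Probability.Percolation.bondPercolation (Literature.Probability.LatticeModels.zdGraph 3) p).real {ω | ω ∈ Literature.Probability.Percolation.openConn x y ∧ (Literature.Probability.Percolation.openGraph ω).dist x y ≤ L} * (q : ℝ) ^ L ≤ (Literature.Probability.Percolation.bondPercolation (Literature.Probability.LatticeModels.zdGraph 3) (q * p)).real (Literature.Probability.Percolation.openConn x y)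

-- earlier TortuosityTransfer (stmt-CriticalPhenomena-11461, replaced 2026-08-15T18:41:46Z -> stmt-CriticalPhenomena-11747): retired by None — NuSupLtOne → ThinningPathBound → StraightRunsRare
/-- item stmt-CriticalPhenomena-11747 · support · rank 9 · closed · proved by Summit.CriticalPhenomena.PercolationContinuityZ3.Theorems.PercReliabilityThinningTortuosityTransfer.tortuosityTransfer_proof @ 0cc6ddf447bd (prover) · by planner
sources: Grimmett1999, Coniglio1982
[support] ThinningPathBound → NuSupLtOne → StraightRunsRare (real analysis, about 150 Lean lines;
rev 1: binder order swapped w.r.t. rev 0 `NuSupLtOne → ThinningPathBound → StraightRunsRare` only so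
that the item re-renders after the restated cruxes — content identical; the mock proof attached to
stmt-CriticalPhenomena-11461 (refuter g43-3, PRTCandidates.lean) applies with its two binders
swapped): given ρ take p = p_c and q = 1 − ε with ε < min(1/2, δ₀/p_c) and ε^(1−ν') < p_c^ν'/(2ρC)
(possible since ν' < 1; 0 < p_c < 1 by Grimmett1999_criticalProb_pos_lt_one_holds), so that (1−ε)p_c
∈ (p_c − δ₀, p_c); then P_(p_c)(0 ↔ ne₁, D ≤ ρn)·(1−ε)^(ρn) ≤ τ_((1−ε)p_c)(0, ne₁) ≤ exp(−(εp_c)^ν'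
n / C) and log(1/(1−ε)) ≤ 2ε give the rate c = (εp_c)^ν'/C − 2ρε > 0 with N = 0. [difficulty:
provable-now] -/
@[route_item "route-CriticalPhenomena-PercReliabilityThinning"]
def TortuosityTransfer : Prop :=
  ThinningPathBound → NuSupLtOne → StraightRunsRare

/-- item stmt-CriticalPhenomena-5265 · support · rank 9 · closed · proved by Summit.CriticalPhenomena.PercolationContinuityZ3.Theorems.thinningLaw_proof @ 5270a6c39a52 (prover) · by planner
sources: LyonsPeres2016, Grimmett1999
[support] THINNING OF THE MONOTONE COUPLING (provable now, ~120 lines): for p q ∈ [0,1], under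
labelMeasure ⊗ P_q the configuration (configOfLabels p U (zdGraph 3)) ∩ eta has law P_{q·p} =
bondPercolation (zdGraph 3) (q * p). Proof: both sides are product measures over edges (setBernoulli
= Measure.pi / infinitePi of Bernoulli): edge e ∈ E(Z^3) is present iff U_e ≤ p and e ∈ eta,
independent events of probabilities p and q, independently over e; identify via Measure.map of the
product of the two infinitePi measures (map_configOfLabels_holds gives the first factor's law; then
the coordinatewise AND of two independent Bernoulli product sets is Bernoulli(pq):
ProdBernoulliCoupling.lean / SprinkledCoupling.lean in tree have the sister statement for sprinkling
(OR)). This is the 'label-fragility identity' (card D5; LyonsPeres2016 Lemma 11.21 device):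
Bernoulli(q) percolation ON omega_p is omega_{qp}. -/
@[route_item "route-CriticalPhenomena-PercReliabilityThinning"]
def ThinningLaw : Prop :=
  ∀ p q : unitInterval, MeasureTheory.Measure.map (fun π : (Sym2 (Fin 3 → ℤ) → ℝ) × Set (Sym2 (Fin 3 → ℤ)) => Literature.Probability.Percolation.configOfLabels (p : ℝ) π.1 (Literature.Probability.LatticeModels.zdGraph 3) ∩ π.2) ((Literature.Probability.Percolation.labelMeasure (Fin 3 → ℤ)).prod (Literature.Probability.Percolation.bondPercolation (Literature.Probability.LatticeModels.zdGraph 3) q)) = Literature.Probability.Percolation.bondPercolation (Literature.Probability.LatticeModels.zdGraph 3) (q * p)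

/-- `ThinningLaw` holds: proved by `Summit.CriticalPhenomena.PercolationContinuityZ3.Theorems.thinningLaw_proof` @ 5270a6c39a52. -/
theorem ThinningLaw_holds : ThinningLaw := _root_.Summit.CriticalPhenomena.PercolationContinuityZ3.Theorems.thinningLaw_proof

/-- item stmt-CriticalPhenomena-11462 · assembly · rank 1 · closed · proved by Summit.CriticalPhenomena.PercolationContinuityZ3.Theorems.PercReliabilityThinningAssembly.assembly_proof @ 0cc6ddf447bd (prover) · by planner
sources: Grimmett1999, AizenmanKestenNewmanCMP1987
[assembly] StraightRunsRare → StraightHighways → PercolationContinuityZ3 (θ(p_c(ℤ³)) = 0), by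
τ_(p_c) ≥ θ(p_c)² and a limit along the subsequence; provable now. -/
@[route_item "route-CriticalPhenomena-PercReliabilityThinning"]
def Assembly : Prop :=
  StraightRunsRare → StraightHighways → PercolationContinuityZ3

/-! D-0027 §2.1 — DECIDING THEOREM (planner-authored via `route open/edit --closes-file`; by planner-rrepair-CriticalPhenomena-PercReliabil-5043789e-0 2026-08-15T18:41:46Z):
its hypotheses are this route's items and its conclusion the sub-problem Statement (glue_lint), and it elaborates with this file. -/

@[closes "route-CriticalPhenomena-PercReliabilityThinning"] theorem closes (h_NuSupLtOne : NuSupLtOne) (h_StraightHighways : StraightHighways)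
    (h_ThinningPathBound : ThinningPathBound) (h_TortuosityTransfer : TortuosityTransfer)
    (h_Assembly : Assembly) : _root_.PercolationContinuityZ3 :=
  h_Assembly (h_TortuosityTransfer h_ThinningPathBound h_NuSupLtOne) h_StraightHighways

end Summit.CriticalPhenomena.PercolationContinuityZ3.Theses.PercReliabilityThinning
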